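import Literature.NumberTheory.Automorphic.RankinSelbergTorusIntegral
import HarnessLib

/-!
# The local geometric factors of a torus majorant and the convergence of their Euler product
(Jacquet–Shalika (1981), §4; Cogdell (2004), §2.3: "absolutely convergent for `Re(s) ≫ 0`")

Topic `NumberTheory/Automorphic`; namespace `Literature.NumberTheory.Automorphic`. Proof file
(theorems only). Elementary bounds for the Euler factorisation of torus integrals of factorizable
majorants (`TorusUnitBoxUnfolding`, `TorusUnitBoxEulerBound`): when the integrand scales under
`ϖ_v^μ`, `μ ∈ ℕⁿ`, by `c_v(μ) = ∏_i x_{v,i}^{μ_i}` with `x_{v,i} = q_v^{-e_i}`, the local factor is a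
product of geometric series and the product over the places converges as soon as every `e_i > 1`:

* `ENNReal.tsum_prod_pow_eq_prod_tsum` — `Σ_{μ ∈ ℕⁿ} ∏_i g_i(μ_i) = ∏_i Σ_k g_i(k)` in `[0, ∞]`;
* `tsum_prod_pow_eq_prod_inv_one_sub` — `Σ_{μ ∈ ℕⁿ} ∏_i x_i^{μ_i} = ∏_i (1 - x_i)⁻¹`;
* `prod_inv_one_sub_residueCard_rpow_le` — for `1 < e_i` and every finite set `F` of finite places,
  `∏_{v ∈ F} ∏_i (1 - q_v^{-e_i})⁻¹ ≤ exp(2 Σ_i Σ_v q_v^{-e_i})` (a bound independent of `F`);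
* `iSup_prod_inv_one_sub_residueCard_rpow_lt_top` (**main**) — hence
  `⨆_F ∏_{v ∈ F} ∏_i (1 - q_v^{-e_i})⁻¹ < ∞` (the Dedekind zeta function converges for `e > 1`,
  `summable_residueCard_rpow_neg`; the elementary inequalities `inv_one_sub_le_exp_two_mul`,
  `residueCard_rpow_neg_le_half` of `MeanSquareSchurGL2`).

## References

* H. Jacquet, J. A. Shalika, Amer. J. Math. 103 (1981), §4 [JacquetShalikaAJM1981].
* J. W. Cogdell, *Analytic theory of L-functions for GL_n* (2004), §2.3 [CogdellAnalyticTheory2004].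
-/

noncomputable section

open MeasureTheory NumberField IsDedekindDomain Set Filter Topology Finset
open scoped ENNReal NNReal

namespace Literature.NumberTheory.Automorphic

/-! ### Sums over `ℕⁿ` of products -/

section PiSum

/-- **`Σ_{μ ∈ ℕⁿ} ∏_i g_i(μ_i) = ∏_i Σ_k g_i(k)`** in `[0, ∞]` (Tonelli for the counting measures,
by induction on `n`). [folklore] -/
theorem ENNReal.tsum_prod_pow_eq_prod_tsum : ∀ (n : ℕ) (g : Fin n → ℕ → ℝ≥0∞),
    ∑' mu : Fin n → ℕ, ∏ i, g i (mu i) = ∏ i, ∑' k, g i k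
  | 0, g => by simp
  | n + 1, g => by
    have ih := ENNReal.tsum_prod_pow_eq_prod_tsum n (fun i => g i.succ)
    rw [Fin.prod_univ_succ, ← ih, ← ENNReal.tsum_mul_right]
    simp_rw [← ENNReal.tsum_mul_left]
    rw [← ENNReal.tsum_prod, ← (Fin.consEquiv (fun _ : Fin (n + 1) => ℕ)).tsum_eq]
    refine tsum_congr fun p => ?_
    rw [Fin.prod_univ_succ]
    simp [Fin.consEquiv]

/-- **`Σ_{μ ∈ ℕⁿ} ∏_i x_i^{μ_i} = ∏_i (1 - x_i)⁻¹`** in `[0, ∞]` (geometric series). [folklore] -/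
theorem tsum_prod_pow_eq_prod_inv_one_sub {n : ℕ} (x : Fin n → ℝ≥0∞) :
    ∑' mu : Fin n → ℕ, ∏ i, x i ^ mu i = ∏ i, (1 - x i)⁻¹ := by
  rw [ENNReal.tsum_prod_pow_eq_prod_tsum n (fun i k => x i ^ k)]
  refine Finset.prod_congr rfl fun i _ => ?_
  exact ENNReal.tsum_geometric (x i)

end PiSum

/-! ### `(1 - x)⁻¹ ≤ exp(2x)` and the Euler product -/

section Euler

variable {K : Type} [Field K] [NumberField K]

/-- **The partial Euler products are bounded**: for `1 < e_i` and every finite set `F` of finite places,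
`∏_{v ∈ F} ∏_i (1 - q_v^{-e_i})⁻¹ ≤ exp(2 Σ_i Σ'_v q_v^{-e_i})` (in `[0, ∞]`, with
`x = ENNReal.ofReal (q_v^{-e_i})`). [folklore] -/
theorem prod_inv_one_sub_residueCard_rpow_le {n : ℕ} (e : Fin n → ℝ) (he : ∀ i, 1 < e i)
    (F : Finset (HeightOneSpectrum (𝓞 K))) :
    ∏ v ∈ F, ∏ i, (1 - ENNReal.ofReal ((v.residueCard : ℝ) ^ (-(e i))))⁻¹ ≤
      ENNReal.ofReal (Real.exp (2 * ∑ i, ∑' v : HeightOneSpectrum (𝓞 K), (v.residueCard : ℝ) ^ (-(e i)))) := by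
  have hx0 : ∀ (v : HeightOneSpectrum (𝓞 K)) i, 0 ≤ (v.residueCard : ℝ) ^ (-(e i)) :=
    fun v i => Real.rpow_nonneg (Nat.cast_nonneg _) _
  have hxh : ∀ (v : HeightOneSpectrum (𝓞 K)) i, (v.residueCard : ℝ) ^ (-(e i)) ≤ 1 / 2 :=
    fun v i => residueCard_rpow_neg_le_half v (he i)
  -- each factor
  have hfac : ∀ (v : HeightOneSpectrum (𝓞 K)) i,
      (1 - ENNReal.ofReal ((v.residueCard : ℝ) ^ (-(e i))))⁻¹ ≤
        ENNReal.ofReal (Real.exp (2 * (v.residueCard : ℝ) ^ (-(e i)))) := by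
    intro v i
    set x : ℝ := (v.residueCard : ℝ) ^ (-(e i)) with hx
    have hx1 : x < 1 := by linarith [hxh v i]
    have h1 : (1 : ℝ≥0∞) - ENNReal.ofReal x = ENNReal.ofReal (1 - x) := by
      rw [← ENNReal.ofReal_one, ← ENNReal.ofReal_sub _ (hx0 v i)]
    rw [h1, ← ENNReal.ofReal_inv_of_pos (by linarith)]
    exact ENNReal.ofReal_le_ofReal (inv_one_sub_le_exp_two_mul (hx0 v i) (hxh v i))
  calc ∏ v ∈ F, ∏ i, (1 - ENNReal.ofReal ((v.residueCard : ℝ) ^ (-(e i))))⁻¹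
      ≤ ∏ v ∈ F, ∏ i, ENNReal.ofReal (Real.exp (2 * (v.residueCard : ℝ) ^ (-(e i)))) :=
        Finset.prod_le_prod' fun v _ => Finset.prod_le_prod' fun i _ => hfac v i
    _ = ENNReal.ofReal (Real.exp (2 * ∑ v ∈ F, ∑ i, (v.residueCard : ℝ) ^ (-(e i)))) := by
        rw [Finset.mul_sum, Real.exp_sum, ENNReal.ofReal_prod_of_nonneg fun v _ => (Real.exp_pos _).le]
        refine Finset.prod_congr rfl fun v _ => ?_
        rw [Finset.mul_sum, Real.exp_sum, ENNReal.ofReal_prod_of_nonneg fun i _ => (Real.exp_pos _).le]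
    _ ≤ ENNReal.ofReal (Real.exp (2 * ∑ i, ∑' v : HeightOneSpectrum (𝓞 K), (v.residueCard : ℝ) ^ (-(e i)))) := by
        refine ENNReal.ofReal_le_ofReal (Real.exp_le_exp.2 ?_)
        refine mul_le_mul_of_nonneg_left ?_ (by norm_num)
        rw [Finset.sum_comm]
        refine Finset.sum_le_sum fun i _ => ?_
        exact (summable_residueCard_rpow_neg (he i)).sum_le_tsum F fun v _ => hx0 v i

/-- **The Euler product of the local geometric factors converges**: for `1 < e_i`,
`⨆_F ∏_{v ∈ F} ∏_i (1 - q_v^{-e_i})⁻¹ < ∞` over the finite sets `F` of finite places (any index type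
of such sets). [folklore] -/
theorem iSup_prod_inv_one_sub_residueCard_rpow_lt_top {n : ℕ} (e : Fin n → ℝ) (he : ∀ i, 1 < e i)
    {ι : Type*} (F : ι → Finset (HeightOneSpectrum (𝓞 K))) :
    (⨆ j, ∏ v ∈ F j, ∏ i, (1 - ENNReal.ofReal (((v.residueCard : ℕ) : ℝ) ^ (-(e i))))⁻¹) < ∞ := by
  refine lt_of_le_of_lt (iSup_le fun j => prod_inv_one_sub_residueCard_rpow_le e he (F j)) ?_
  exact ENNReal.ofReal_lt_top

end Euler

end Literature.NumberTheory.Automorphic
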